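import Literature.AlgebraicGeometry.Resolution.RegularLocalLU
import Literature.AlgebraicGeometry.Resolution.RegularLocalRingsProofs
import Literature.AlgebraicGeometry.Resolution.ExcellentRings
import Mathlib.Algebra.CharP.Lemmas
import HarnessLib

/-!
# Cossart–Piltant's small-multiplicity theorem one dimension up: `SmallMultLU(d)`, typed

Topic: `Literature/AlgebraicGeometry/CossartPiltant2008to2019` — typed skeleton of PUBLISHED
work (V. Cossart, O. Piltant, *Resolution of singularities of threefolds in mixed
characteristic: case of small multiplicity*, RACSAM **108** (2014) 113–151 = HAL
hal-00735929, "[CoP4]"), written for the dimension-`4` obstruction census of the cell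
`pub-hironaka` (unit `b2b-hironaka-cp4`, `OBSTRUCTIONS-DIM4.md` §12.1, §13, row **OB-2**).
Companion of `DimensionFourChain.lean` (the `m(x) = p` local theorem of Cossart–Piltant 2019
with `3 ↦ n`) and of the abstract node skeleton
`CossartPiltant200819/SmallMultiplicity2014.lean` (which renders the PROOF of [CoP4] over an
abstract `Setting`; this file renders its STATEMENT over concrete rings).

## What is reproduced, and what is not

[CoP4] Main Theorem 0.3, VERBATIM (ms p. 1–2): "Let `(R, M, k = k(x) := R/M)` be an excellent
regular local ring of dimension four, `(Z, x) := (Spec R, M)` and `(X, x) := (Spec R/(h), x)`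
be a reduced hypersurface. Assume that the multiplicity `m(x)` of `(X, x)` satisfies
`m(x) < p := char k(x)`. Let `v` be a valuation of `K(X)` centered at `x`. Then there exists a
finite sequence of local blowing ups `(X, x) =: (X₀, x₀) ← (X₁, x₁) ← ⋯ ← (X_n, x_n)`, where
`x_i ∈ X_i`, `0 ≤ i ≤ n` is the center of `v`, each blowing up center `Y_i ⊂ X_i` is permissible
at `x_i` (in Hironaka's sense), such that `x_n` is regular."

Rendered here with `dim R = 4` replaced by a parameter `d`, in the WEAK local-uniformization
form in which the tree vendors Cossart–Piltant's local statements (`CPLocalUniformization`, the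
property (LU) of Cossart–Piltant 2019 §4.1, file `Resolution/ArithmeticalThreefolds.lean`):
case `h` irreducible (`(h)` prime, so `X` is integral and `K(X) = Frac(R/(h))`); for every
valuation ring of `K(X)` dominating `R/(h)` with residue field algebraic over `k(x)` there is a
finitely generated `R/(h)`-subalgebra `T` of the valuation ring whose localization at the centre
is regular. This is implied by the printed conclusion (a composite of local blowing ups along
`v` is such a `T` localized) and forgets the Hironaka-permissibility of the centres, exactly as
the tree's `CossartPiltant2019Local` does for the `m(x) = p` theorem. The multiplicity of the
hypersurface germ `Spec R/(h)` at `x` is `ord_M(h) = max {m : h ∈ M^m}` (`R` regular), so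
"`m(x) < p := char k(x)`" is rendered as `∀ m, h ∈ M^m → m < p` together with
`CharP (R/M) p`; as printed, the hypothesis is unsatisfiable when `char k(x) = 0`.

* `SmallMultLUInDimOfChar d p`, `SmallMultLUInDim d` (`:= ∀` residue characteristics `p`) —
  `Prop`-valued predicates in `d`, ASSERTED NOWHERE. PRINTED AND PROVED for `d = 4` ([CoP4]
  Thm. 0.3; not vendored as a named fact here — the cell's census uses it only as a node);
  `d = 5` is the census's open input OB-2(5) ("SmallMultLU(5): OPEN-INPUT", §12.1): the
  printed proof uses `dim R = 4` at Prop. III.1 (embedded resolution of the surface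
  `Sing_m(X)` — a threefold one dimension up, census O1), Thms. II.10–II.11 (`dim Σ ≤ 1`) and
  §VI (projection of `Δ(h; u₁,u₂,u₃)` to a polygon).
* PROVED bookkeeping, every `d`: `cpLocalUniformization_quotient_of_not_mem_sq` (the
  `m(x) = 1` instances hold: `h ∈ M ∖ M²` makes `R/(h)` regular, Matsumura 14.2, and a regular
  local domain is its own local uniformization — tree lemmas `quotient_span_singleton`,
  `cpLocalUniformization_of_isRegularLocalRing`); `smallMultLUInDimOfChar_two` (**the residue
  characteristic `2` slice of `SmallMultLU(d)` holds in EVERY dimension**: `m(x) < 2` forces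
  `m(x) = 1`); `smallMultLUInDimOfChar_zero` (residue characteristic `0`: vacuous as printed);
  `smallMultLUInDim_iff_prime` (only prime residue characteristics `p ≥ 3` carry content).
  Consequently the open input OB-2(5) is exactly `SmallMultLUInDimOfChar 5 p` for primes
  `p ≥ 3` (`smallMultLUInDim_five_iff`).

Nothing here is asserted about `d = 5`; no blow-ups, characteristic polyhedra or
Hironaka-permissibility (absent from Mathlib) appear. [cite: CossartPiltant2012, Thm. 0.3]
-/

noncomputable section

open IsLocalRing

namespace Literature.AlgebraicGeometry.CossartPiltant2008to2019

open Literature.AlgebraicGeometry.Resolution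

universe u

/-! ## The statement with `4 ↦ d` -/

/-- **[CoP4] Main Theorem 0.3 in ambient dimension `d` and residue characteristic `p`**, weak
local-uniformization form, case `h` irreducible: for every excellent regular local ring `R` of
Krull dimension `d` whose residue field has characteristic `p`, and every `h ∈ M_R` generating a
prime ideal with `ord_M(h) < p` ("`m(x) < p := char k(x)`"), the local domain `R/(h)` has
Cossart–Piltant's property (LU) (`CPLocalUniformization`). PRINTED AND PROVED for `d = 4`
only; a predicate in `d`, asserted nowhere. [cite: CossartPiltant2012, Thm. 0.3, with 4 ↦ d] -/
def SmallMultLUInDimOfChar (d p : ℕ) : Prop :=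
  ∀ (R : Type u) [CommRing R] [IsDomain R] [IsRegularLocalRing R],
    IsExcellentRing R → ringKrullDim R = d → CharP (ResidueField R) p →
  ∀ (h : R), h ∈ maximalIdeal R → (hprime : (Ideal.span {h}).IsPrime) →
    (∀ m : ℕ, h ∈ maximalIdeal R ^ m → m < p) →
    letI : (Ideal.span {h}).IsPrime := hprime
    letI : IsLocalRing (R ⧸ Ideal.span {h}) :=
      IsLocalRing.of_surjective' (Ideal.Quotient.mk (Ideal.span {h})) Ideal.Quotient.mk_surjective
    CPLocalUniformization (R ⧸ Ideal.span {h})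

/-- **`SmallMultLU(d)`** of the census (row OB-2): [CoP4] Thm. 0.3 with `4 ↦ d`, over all
residue characteristics ("`p := char k(x)`"). [cite: CossartPiltant2012, Thm. 0.3, with 4 ↦ d] -/
def SmallMultLUInDim (d : ℕ) : Prop :=
  ∀ p : ℕ, SmallMultLUInDimOfChar.{u} d p

/-! ## Bookkeeping proved in every dimension -/

/-- The rendering of "`m(x) < p`": if every `m` with `h ∈ M^m` is `< p` then in particular
`0 < p` (take `m = 0`). [folklore] -/
theorem pos_of_forall_mem_pow_lt {R : Type u} [CommRing R] [IsLocalRing R] {h : R} {p : ℕ}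
    (hm : ∀ m : ℕ, h ∈ maximalIdeal R ^ m → m < p) : 0 < p :=
  hm 0 (by simp)

/-- The rendering of "`m(x) < 2`": `h ∉ M²`. [folklore] -/
theorem not_mem_sq_of_forall_mem_pow_lt_two {R : Type u} [CommRing R] [IsLocalRing R] {h : R}
    (hm : ∀ m : ℕ, h ∈ maximalIdeal R ^ m → m < 2) : h ∉ maximalIdeal R ^ 2 :=
  fun h2 => lt_irrefl 2 (hm 2 h2)

/-- **The `m(x) = 1` instances of `SmallMultLU(d)` hold in every dimension**: for a regular
local ring `R` (any dimension, any characteristics) and `h ∈ M ∖ M²`, the hypersurface ring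
`R/(h)` is a regular local ring (Matsumura, Thm. 14.2 — tree `quotient_span_singleton`), hence
a domain (Thm. 14.3), and a regular local domain has (LU) with `T := R/(h)` itself (tree
`cpLocalUniformization_of_isRegularLocalRing`, Cossart–Piltant 2019 proof of Prop. 4.10:
"(LU v₀) holds by construction since S is regular").
[cite: Matsumura1987, Thm. 14.2] [cite: CossartPiltant2019, proof of Prop. 4.10 (arXiv v1: Prop. 4.8)] -/
theorem cpLocalUniformization_quotient_of_not_mem_sq (R : Type u) [CommRing R]
    [IsRegularLocalRing R] {h : R} (hM : h ∈ maximalIdeal R) (h2 : h ∉ maximalIdeal R ^ 2) :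
    haveI : IsRegularLocalRing (R ⧸ Ideal.span {h}) := (quotient_span_singleton R hM h2).1
    haveI : IsDomain (R ⧸ Ideal.span {h}) := isDomain_of_isRegularLocalRing (R ⧸ Ideal.span {h})
    CPLocalUniformization (R ⧸ Ideal.span {h}) := by
  haveI : IsRegularLocalRing (R ⧸ Ideal.span {h}) := (quotient_span_singleton R hM h2).1
  haveI : IsDomain (R ⧸ Ideal.span {h}) := isDomain_of_isRegularLocalRing (R ⧸ Ideal.span {h})
  exact cpLocalUniformization_of_isRegularLocalRing (R ⧸ Ideal.span {h})

/-- **Residue characteristic `2`: `SmallMultLU(d)` holds in EVERY dimension `d`** — the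
hypothesis `m(x) < 2` forces `m(x) = 1`, i.e. `h ∉ M²`, and then `R/(h)` is regular
(`cpLocalUniformization_quotient_of_not_mem_sq`). So [CoP4]'s theorem and its open analogue
OB-2(`d`), `d ≥ 5`, carry content only for residue characteristic `p ≥ 3`. [folklore] -/
theorem smallMultLUInDimOfChar_two (d : ℕ) : SmallMultLUInDimOfChar.{u} d 2 := by
  intro R _ _ _ _ _ _ h hM hprime hm
  have h2 : h ∉ maximalIdeal R ^ 2 := not_mem_sq_of_forall_mem_pow_lt_two hm
  -- the instances chosen in the statement and in the lemma are propositionally equal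
  have := cpLocalUniformization_quotient_of_not_mem_sq R hM h2
  convert this

/-- **Residue characteristic `0`: the statement is vacuous as printed** ("`m(x) < p :=
char k(x)`" cannot hold with `p = 0`). [folklore] -/
theorem smallMultLUInDimOfChar_zero (d : ℕ) : SmallMultLUInDimOfChar.{u} d 0 := by
  intro R _ _ _ _ _ _ h _ _ hm
  exact absurd (pos_of_forall_mem_pow_lt hm) (lt_irrefl 0)

/-- The residue field of a local ring has characteristic `0` or a prime; so `SmallMultLU(d)` is
the conjunction of its prime-characteristic slices. [folklore] -/
theorem smallMultLUInDim_iff_prime (d : ℕ) :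
    SmallMultLUInDim.{u} d ↔ ∀ p : ℕ, p.Prime → SmallMultLUInDimOfChar.{u} d p := by
  refine ⟨fun H p _ => H p, fun H p => ?_⟩
  intro R _ _ _ hexc hdim hchar h hM hprime hm
  by_cases hp0 : p = 0
  · subst hp0
    exact smallMultLUInDimOfChar_zero d R hexc hdim hchar h hM hprime hm
  · haveI := hchar
    have hp : p.Prime := CharP.char_prime_of_ne_zero (ResidueField R) hp0
    exact H p hp R hexc hdim hchar h hM hprime hm

/-- Only primes `p ≥ 3` carry content: the slices `p = 0` and `p = 2` are theorems in every
dimension. [folklore] -/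
theorem smallMultLUInDim_iff_three_le (d : ℕ) :
    SmallMultLUInDim.{u} d ↔ ∀ p : ℕ, p.Prime → 3 ≤ p → SmallMultLUInDimOfChar.{u} d p := by
  rw [smallMultLUInDim_iff_prime]
  refine ⟨fun H p hp _ => H p hp, fun H p hp => ?_⟩
  by_cases h3 : 3 ≤ p
  · exact H p hp h3
  · have hp2 : p = 2 := by
      have := hp.two_le
      omega
    subst hp2
    exact smallMultLUInDimOfChar_two d

/-- **The census's open input OB-2(5), isolated**: `SmallMultLU(5)` — [CoP4]'s theorem for
fourfold hypersurface germs of multiplicity `< p` in excellent regular local rings of dimension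
`5` — is exactly the conjunction of its slices at primes `p ≥ 3`; nothing about it is asserted.
[cite: CossartPiltant2012, Thm. 0.3, with 4 ↦ 5] -/
theorem smallMultLUInDim_five_iff :
    SmallMultLUInDim.{u} 5 ↔ ∀ p : ℕ, p.Prime → 3 ≤ p → SmallMultLUInDimOfChar.{u} 5 p :=
  smallMultLUInDim_iff_three_le 5

end Literature.AlgebraicGeometry.CossartPiltant2008to2019
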